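import Summits.QuantumFields.YangMills.Theorems.BalabanUVNodesN15TwoSpacingGluingCurvedKnitCovariantLandauGlobalRows
import HarnessLib

/-!
# THE GLUING STEP AT TWO LATTICE SPACINGS — PROGRAMME (P-S), VII: n15-c∕211's NODE THEOREM WITH THE THREE GLOBAL LANDAU ROWS REQUIRED ONLY BELOW A FIELD-SIZE THRESHOLD
# (`L^mα₀ ≤ a_G`) — the form the propagator-row derivation of n15-c∕212–217 delivers them in (dag-n15-c g23, n15-c∕207b)

Cell `pub-ymgap`, seat `pub-ymgap-dag-n15-c` (R134 (a); HUMAN RULING D-0062), generation 23.  `bears_on: R4∕N15 · K3⁸ SpineGivenEndpointR13SepCoPHV (stmt-QuantumFields-27366)`.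
Filed `--supports stmt-QuantumFields-27366 --as helper` — COUNT-NEUTRAL.  One theorem; 0 `sorry`; NO estimate.  = n15-c∕207 `ne2PlusOperator_sfqr` VERBATIM (same proof text, same constants)
except that the Landau-letter hypothesis is n15-c∕211's THREE-ROW `hG` (coarse row, fine row, two-grid η-defect of `N_V^R`, one rate `δ_R`) required only for `L^m·α₀ ≤ a_G`
(`a_G > 0` part of the witness): the threshold `a₀` of the NE2⁺ template gains `a_G` in its `min`, and the six rows of n15-c∕206 are produced by n15-c∕211 `cv_landauRows_of_global`.
Imports BY NAME n15-c∕211 (and through it 207, 207a, 206, 189b, 133, 132).  Nothing in the tree is modified.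

WHY.  n15-c∕217 `hasMaj_landauCov_sub_of_flat` delivers the global row of `N_V^R` with size `c_R·r_A` only for `r_A = c₃₅L^mα₀` below an explicit threshold (`landauSmallConst·r_A ≤ 1`:
two Neumann series), while n15-c∕211 `ne2PlusOperator_sfqr_of_global` asks the rows for every `α₀ > 0`.  [Balaban1985BackgroundPropagators] Thm 3.1's template (3.42) has exactly such a
threshold («for Mα₀ ≤ a₀»), and so does `T4EtaRate.NE2PlusOperator`; this file threads it through.
* ★★★ `ne2PlusOperator_sfqr_of_global_small : NE2PlusOperator c₃₅ (sfInstance d mm ι hL) (fun i => sfqrFamily d mm ι a e hL i (E i))` from `hE` (entries 1–3) and the thresholded `hG`.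

HONEST FRAMING ∕ LIMITS.  Plumbing on MODEL carriers; the three global rows are HYPOTHESES here (derived from the flat propagator rows + one covariant gradient-difference row in n15-c∕217,
per grid; the node-level instantiation is the sequel); NOT [B9] Thm 3.1∕3.14 as printed; NE2⁺ NOT PRINTED; N15 of record untouched (DISCHARGED AS CONSUMED, p687738); counts UNMOVED
(typed 28∕28 · discharged 8∕27); one finite 𝕋⁴ at fixed ε per index — NOT infinite volume ∕ OS ∕ mass gap ∕ Clay.  Restate-immune (no Theses import).
-/

noncomputable section

open scoped BigOperators Matrix

namespace Summit.QuantumFields.YangMills.BalabanUVNodes.N15.Gluing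

open Literature.MathematicalPhysics.QuantumFieldTheory.Balaban1983to89
open Literature.MathematicalPhysics.QuantumFieldTheory.Balaban1983to89.B11SectG (BlockNorm HasMaj)
open Literature.MathematicalPhysics.QuantumFieldTheory.Balaban1983to89.T4EtaRateDefect (idef)
open Literature.MathematicalPhysics.QuantumFieldTheory.Balaban1983to89.T4EtaRateCoeffDefect (pull)
open Literature.MathematicalPhysics.QuantumFieldTheory.Balaban1983to89.B6Prop26Gluing (mulOp)
open Literature.MathematicalPhysics.QuantumFieldTheory.Balaban1983to89.B6UnitTorusCarrier (unitTorusGeo unitTorusGeo_dist_nonneg)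
open Literature.MathematicalPhysics.QuantumFieldTheory.Balaban1983to89.B5Prop11Plancherel (Tor)
open Summit.QuantumFields.YangMills.BalabanUVNodes.N15.BackgroundLayer (gavgM)
open Literature.MathematicalPhysics.QuantumFieldTheory.Balaban1983to89.T4EtaRate (NE2PlusOperator EtaRateIneq342 rateFactor rateFactor_nonneg)
open Literature.Barriers.QuantumFields (traceForm)
open Summit.QuantumFields.YangMills.BalabanUVNodes.N15.VectorPiece (bshiftEquiv kingPrV unitTorusGeoS)
open Summit.QuantumFields.YangMills.BalabanUVNodes.N15.MatrixSpecies (liftBlk liftMap basisConst basisConst_nonneg)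
open Summit.QuantumFields.YangMills.BalabanUVNodes.N15.OperatorReadout (opGeo opFamily opGeo_len rateFactor_opGeo etaRateIneq342_of_hasMaj pref4_pos)
open Literature.NumberTheory.Sieve.SquarefreeSums (exp_sub_one_le_two_mul)

variable {d : ℕ} {L : ℕ} [NeZero L]

/-! ## §1 `NE2PlusOperator` by name for the (P-R) family: entry 0 constructed, its Landau-letter rows and entries 1–3 displayed -/

section Node

open scoped Matrix.Norms.L2Operator

variable (d) (mm ι : Type) [Fintype mm] [DecidableEq mm] [Nonempty mm] [Fintype ι] [DecidableEq ι] (e : Matrix mm mm ℂ ≃L[ℝ] (ι → ℝ))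

set_option maxHeartbeats 1600000 in
/-- ★★★ (n15-c∕207 WITH THE THREE GLOBAL LANDAU ROWS OF n15-c∕211 REQUIRED ONLY FOR `L^mα₀ ≤ a_G`.)  **NE2⁺, OPERATOR LAYER, BY NAME, FOR THE GLUED FAMILY OF THE COVER WITH BAŁABAN's FULLY COVARIANT SUMMAND `a·Q*(U)Q(U) − D_U(I − R(U))D*_U` LIVE — ENTRY 0 CONSTRUCTED,
ITS SIX LANDAU-LETTER ROWS AND ENTRIES 1–3 DISPLAYED, `M = L^m` LIVE.**  For odd `L ≥ 7`, `a > 0`, `c₃₅ > 0`, trace-form coordinates `e` of `𝔲(m)` (operator norms): if the consumer's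
entries 1–3 obey FILE 132's displayed (3.42)-shaped row (`hE`), and the Landau perturbation letter `N_V^R = ∂Π∂* ⊗ 1 − D_U(I − R(U))D*_U` of both grids obeys, in the class (3.35),
the six localisation rows of n15-c∕206 at one rate `δ_R` with sizes `c_R·c₃₅L^mα₀` (near∕far) and `C_R·(L^k)^{−γ_R}` (two-grid defect) (`hR`), then
`NE2PlusOperator c₃₅ (sfInstance d mm ι hL) (fun i => sfqrFamily d mm ι a e hL i (E i))` — whose ENTRY 0 is the η-defect of the glued propagators with the whole covariant summand
`P = N_L ⊗ 1 − N_V^Q − N_V^R` live (n15-c∕206, NO displayed row beyond `hR`).  MODEL family; `Q(U)` = main term (125); NOT [B9] Thm 3.1∕3.14 as printed.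
[cite: Balaban1985BackgroundPropagators, Thm 3.1 p.397 (quantifier template, (3.42)), (3.25)–(3.26) p.395, (3.49) p.398 (shape of the Landau-letter rows), Thm 3.14 pp.426–427 (difference template), (3.35)–(3.36) p.396; Balaban1985Averaging, (124)–(125) p.36; King1986, Prop. 3.9 (3.73) p.665 (rate factor); Balaban1984PropagatorsII, (2.91)–(2.93) p.239] -/
theorem ne2PlusOperator_sfqr_of_global_small (hL : Odd L ∧ 1 < L) (hL7 : 7 ≤ L) {a : ℝ} (ha : 0 < a) {c35 : ℝ} (hc35 : 0 < c35) (he : ∀ A B : Matrix mm mm ℂ, traceForm A B = e A ⬝ᵥ e B)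
    (E : ∀ i : SfIdx d L, Fin 4 → (Fin (d + 1) → CvX' d L i.m i.kk i.r hL → Matrix mm mm ℂ) → ((CvX d L i.m i.kk hL × ι → ℝ) →ₗ[ℝ] (CvX' d L i.m i.kk i.r hL × ι → ℝ)))
    (hE : ∃ M₁ δ₁ a₁ B₁ γ₁ : ℝ, 0 < M₁ ∧ 0 < δ₁ ∧ 0 < a₁ ∧ 0 < B₁ ∧ 0 < γ₁ ∧
      ∀ i : SfIdx d L, M₁ ≤ (L : ℝ) ^ i.m → ∀ α₀ : ℝ, 0 < α₀ → (L : ℝ) ^ i.m * α₀ ≤ a₁ →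
        ∀ A' : Fin (d + 1) → CvX' d L i.m i.kk i.r hL → Matrix mm mm ℂ, (sfInstance d mm ι hL i).Bf.Reg335 c35 α₀ A' → ∀ n : Fin 4, n ≠ 0 →
          HasMaj (BlockNorm.ofBlocks (sfGeo d hL i) (liftBlk (cvBlk d L i.m i.kk hL) ι))
            (BlockNorm.ofBlocks (sfGeo d hL i) (liftBlk (cvBlk d L i.m i.kk hL ∘ kingPrV L i.kk i.r (cvM d L i.m i.kk hL)) ι)) (E i n A')
            (fun y y' => B₁ * B9.pref4 ((opGeo (sfGeo d hL i) (CvX d L i.m i.kk hL × ι) (liftBlk (cvBlk d L i.m i.kk hL) ι)).len y) n * Real.exp (-(δ₁ * (sfGeo d hL i).dist y y')) *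
              max (rateFactor (opGeo (sfGeo d hL i) (CvX d L i.m i.kk hL × ι) (liftBlk (cvBlk d L i.m i.kk hL) ι)) γ₁ y)
                (rateFactor (opGeo (sfGeo d hL i) (CvX d L i.m i.kk hL × ι) (liftBlk (cvBlk d L i.m i.kk hL) ι)) γ₁ y')))
    (hG : ∃ δR cR CR γR aG : ℝ, 0 < δR ∧ 0 ≤ cR ∧ 0 ≤ CR ∧ 0 < γR ∧ 0 < aG ∧
      ∀ i : SfIdx d L, ∀ α₀ : ℝ, 0 < α₀ → (L : ℝ) ^ i.m * α₀ ≤ aG → ∀ A' : Fin (d + 1) → CvX' d L i.m i.kk i.r hL → Matrix mm mm ℂ, (sfInstance d mm ι hL i).Bf.Reg335 c35 α₀ A' →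
        HasMaj (CvNorm d L i.m i.kk hL ι) (CvNorm d L i.m i.kk hL ι) (cvNVr d L i.m i.kk hL a ι e (fun μ x => NormedSpace.exp (((((L ^ i.kk : ℕ) : ℝ))⁻¹) • gavgM (Matrix mm mm ℂ) (Fin (d + 1)) (kingPrV L i.kk i.r (cvM d L i.m i.kk hL)) A' μ x))) (fun y y' => (cR * (c35 * (L : ℝ) ^ i.m * α₀)) * Real.exp (-(δR * (unitTorusGeo L i.kk (cvM d L i.m i.kk hL)).dist y y'))) ∧
        HasMaj (BlockNorm.ofBlocks (unitTorusGeo L i.kk (cvM d L i.m i.kk hL)) (liftBlk (cvBlk d L i.m i.kk hL ∘ (kingPrV L i.kk i.r (cvM d L i.m i.kk hL))) ι)) (BlockNorm.ofBlocks (unitTorusGeo L i.kk (cvM d L i.m i.kk hL)) (liftBlk (cvBlk d L i.m i.kk hL ∘ (kingPrV L i.kk i.r (cvM d L i.m i.kk hL))) ι)) (cvNVr' d L i.m i.kk i.r hL a ι e (fun μ x' => NormedSpace.exp (((((L ^ i.r * L ^ i.kk : ℕ) : ℝ))⁻¹) • A' μ x'))) (fun y y' => (cR * (c35 * (L : ℝ)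 ^ i.m * α₀)) * Real.exp (-(δR * (unitTorusGeo L i.kk (cvM d L i.m i.kk hL)).dist y y'))) ∧
        HasMaj (CvNorm d L i.m i.kk hL ι) (BlockNorm.ofBlocks (unitTorusGeo L i.kk (cvM d L i.m i.kk hL)) (liftBlk (cvBlk d L i.m i.kk hL ∘ (kingPrV L i.kk i.r (cvM d L i.m i.kk hL))) ι)) (idef (pull (liftMap (kingPrV L i.kk i.r (cvM d L i.m i.kk hL)) ι)) (pull (liftMap (kingPrV L i.kk i.r (cvM d L i.m i.kk hL)) ι)) (cvNVr' d L i.m i.kk i.r hL a ι e (fun μ x' => NormedSpace.exp (((((L ^ i.r * L ^ i.kk : ℕ) : ℝ))⁻¹) • A' μ x'))) (cvNVr d L i.m i.kk hL a ι e (fun μ x => NormedSpace.exp (((((L ^ i.kk : ℕ) : ℝ))⁻¹) • gavgM (Matrix mm mm ℂ) (Fin (d + 1)) (kingPrV L i.kk i.r (cvM d L i.m i.kk hL)) A' μ x)))) (fun y y' => (CR * ((L : ℝ) ^ i.kk) ^ (-γR)) * Real.exp (-(δR * (unitTorusGeo L i.kk (cvM d L i.m i.kk hL)).dist y y')))) 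:
    NE2PlusOperator c35 (sfInstance d mm ι hL) (fun i => sfqrFamily d mm ι a e hL i (E i)) := by
  obtain ⟨δR, cR, CR, γR, aG, hδR, hcR, hCR, hγR, haG, hG⟩ := hG
  obtain ⟨δ, w₀, R₀, θ₀, R₁, D, hδ, hδcap, hR₀, hθ₀, hR₁, H⟩ := sfqr_idef_cvGlued (d := d) hL hL7 ha ι hδR
  obtain ⟨M₁, δ₁, a₁, B₁, γ₁, hM₁, hδ₁, ha₁, hB₁, hγ₁, hE⟩ := hE
  have hLpos : 0 < L := Nat.pos_of_ne_zero (NeZero.ne L)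
  have hLr : (0 : ℝ) < (L : ℝ) := Nat.cast_pos.mpr hLpos
  have hL1 : (1 : ℝ) ≤ (L : ℝ) := by exact_mod_cast hLpos
  -- the constants
  have hκ0 : 0 ≤ basisConst e := basisConst_nonneg e
  have hκF := @basisConst_nonneg ι _ (Matrix mm mm ℂ) Matrix.frobeniusNormedAddCommGroup Matrix.frobeniusNormedSpace e
  let σ : ℝ := 14 * Real.exp 1 * (1 + Fintype.card (Fin (d + 1))) * basisConst e * ((1 + Fintype.card (Fin (d + 1))) * (3 + 2 * ((d : ℝ) + 1)))
  have hσ0 : 0 ≤ σ := by positivity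
  let JJ : ℝ := 1 + Fintype.card (Fin (d + 1) ⊕ Fin (d + 1))
  have hJJ0 : 0 ≤ JJ := by positivity
  let W : ℝ := 2 * ((1 + Fintype.card (Fin (d + 1))) * (3 + 2 * ((d : ℝ) + 1)))
  have hW0 : 0 < W := by positivity
  have hW1 : 1 ≤ W := by
    show (1 : ℝ) ≤ 2 * ((1 + Fintype.card (Fin (d + 1))) * (3 + 2 * ((d : ℝ) + 1)))
    have h1 : (1 : ℝ) ≤ 1 + Fintype.card (Fin (d + 1)) := le_add_of_nonneg_right (Nat.cast_nonneg _)
    have h2 : (1 : ℝ) ≤ 3 + 2 * ((d : ℝ) + 1) := by have := (Nat.cast_nonneg d : (0 : ℝ) ≤ d); linarith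
    nlinarith
  let Λ : ℝ := (Fintype.card ι * (@basisConst ι _ (Matrix mm mm ℂ) Matrix.frobeniusNormedAddCommGroup Matrix.frobeniusNormedSpace e * (2 * Real.sqrt (Fintype.card mm)) * Real.sqrt (Fintype.card mm)))
  have hΛ0 : 0 ≤ Λ := by positivity
  let cΦ : ℝ := (3 ^ (d + 1) * (72 * ((d : ℝ) + 1) ^ 2 + 9 * ((d : ℝ) + 1)) + (2 + 2 * Real.exp 1 + 2 * Real.exp 1 ^ 2 * ((d : ℝ) + 1)))
  have hcΦ0 : 0 ≤ cΦ := by positivity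
  let G : ℝ := 8 * ((d : ℝ) + 2) * Λ
  have hG0 : 0 ≤ G := by positivity
  let aW : ℝ := 1 / (W * c35)
  have haW : 0 < aW := by positivity
  let aK : ℝ := 1 / ((4 * ((d : ℝ) + 2) * Λ + 1) * c35)
  have haK : 0 < aK := by positivity
  let aR : ℝ := R₀ / (σ * c35 * JJ + R₁ * G * c35 + cR * c35 + 1)
  have haR : 0 < aR := by positivity
  let aθ : ℝ := θ₀ / (R₁ * G * c35 + cR * c35 + 1)
  have haθ : 0 < aθ := by positivity
  let a₀₀ : ℝ := min a₁ (min aW (min aR (min aθ aK)))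
  have ha₀₀ : 0 < a₀₀ := lt_min ha₁ (lt_min haW (lt_min haR (lt_min haθ haK)))
  let a₀ : ℝ := min a₀₀ aG
  have ha₀ : 0 < a₀ := lt_min ha₀₀ haG
  have ha₀a₁ : a₀ ≤ a₁ := (min_le_left _ _).trans (min_le_left _ _)
  have ha₀W : a₀ ≤ aW := (min_le_left _ _).trans ((min_le_right _ _).trans (min_le_left _ _))
  have ha₀R : a₀ ≤ aR := (min_le_left _ _).trans ((min_le_right _ _).trans ((min_le_right _ _).trans (min_le_left _ _)))
  have ha₀θ : a₀ ≤ aθ := (min_le_left _ _).trans ((min_le_right _ _).trans ((min_le_right _ _).trans ((min_le_right _ _).trans (min_le_left _ _))))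
  have ha₀K : a₀ ≤ aK := (min_le_left _ _).trans ((min_le_right _ _).trans ((min_le_right _ _).trans ((min_le_right _ _).trans (min_le_right _ _))))
  have ha₀G : a₀ ≤ aG := min_le_right _ _
  let M₅ : ℝ := max (max w₀ M₁) 1
  have hM₅ : 0 < M₅ := lt_of_lt_of_le one_pos (le_max_right _ _)
  let δ₀ : ℝ := min (δ / 16) δ₁
  have hδ₀ : 0 < δ₀ := lt_min (by positivity) hδ₁
  let γ : ℝ := min (min (1 / 16 : ℝ) γ₁) γR
  have hγ : 0 < γ := lt_min (lt_min (by norm_num) hγ₁) hγR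
  let C₁ : ℝ := σ * (c35 * a₀) * JJ + 2 * (R₁ * (20 + 4 * (Λ * cΦ * (c35 * a₀))))
  have hC₁0 : 0 ≤ C₁ := by positivity
  let B₀ : ℝ := max D 0 * (1 + C₁ + 2 * CR) + B₁
  have hB₀ : 0 < B₀ := add_pos_of_nonneg_of_pos (by positivity) hB₁
  refine ⟨M₅, δ₀, a₀, B₀, γ, hM₅, hδ₀, ha₀, hB₀, hγ, fun i hM α₀ hα₀ hMa A' hA' => ?_⟩
  -- the guard `M₅ ≤ gf.M = L^m`
  have hM' : M₅ ≤ (L : ℝ) ^ i.m := hM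
  have hw₀ : w₀ ≤ ((L ^ i.m : ℕ) : ℝ) := by push_cast; exact ((le_max_left _ _).trans (le_max_left _ _)).trans hM'
  have hM₁' : M₁ ≤ (L : ℝ) ^ i.m := ((le_max_right _ _).trans (le_max_left _ _)).trans hM'
  have hMa₁ : (L : ℝ) ^ i.m * α₀ ≤ a₁ := hMa.trans ha₀a₁
  have hη0 : (0 : ℝ) ≤ (sfGeo d hL i).eta := by
    show (0 : ℝ) ≤ ((L : ℝ) ^ i.kk)⁻¹
    positivity
  -- the scalar facts at the index
  have hx1 : (1 : ℝ) ≤ (L : ℝ) ^ i.kk := one_le_pow₀ hL1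
  have hxpos : (0 : ℝ) < (L : ℝ) ^ i.kk := pow_pos hLr _
  have hcast : (((L ^ i.kk : ℕ) : ℝ)) = (L : ℝ) ^ i.kk := by push_cast; rfl
  have hrf : ∀ y : (sfGeo d hL i).Site, ∀ γ' : ℝ, rateFactor (opGeo (sfGeo d hL i) (CvX d L i.m i.kk hL × ι) (liftBlk (cvBlk d L i.m i.kk hL) ι)) γ' y = ((L : ℝ) ^ i.kk) ^ (-γ') :=
    fun y γ' => sfGeo_rateFactor d hL i _ γ' y
  have hγle : γ ≤ 1 / 16 := (min_le_left _ _).trans (min_le_left _ _)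
  have hγle₁ : γ ≤ γ₁ := (min_le_left _ _).trans (min_le_right _ _)
  have hγleR : γ ≤ γR := min_le_right _ _
  have hrfγR : ((L : ℝ) ^ i.kk) ^ (-γR) ≤ ((L : ℝ) ^ i.kk) ^ (-γ) := Real.rpow_le_rpow_of_exponent_le hx1 (by linarith)
  have hrfγ : ((L : ℝ) ^ i.kk) ^ (-(1 / 16 : ℝ)) ≤ ((L : ℝ) ^ i.kk) ^ (-γ) := Real.rpow_le_rpow_of_exponent_le hx1 (by linarith)
  have hrfγ₁ : ((L : ℝ) ^ i.kk) ^ (-γ₁) ≤ ((L : ℝ) ^ i.kk) ^ (-γ) := Real.rpow_le_rpow_of_exponent_le hx1 (by linarith)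
  have hinv : ((L : ℝ) ^ i.kk)⁻¹ ≤ ((L : ℝ) ^ i.kk) ^ (-(1 / 16 : ℝ)) := by
    rw [← Real.rpow_neg_one]
    exact Real.rpow_le_rpow_of_exponent_le hx1 (by norm_num)
  have hδ₀le : δ₀ ≤ δ / 16 := min_le_left _ _
  have hδ₀le₁ : δ₀ ≤ δ₁ := min_le_right _ _
  refine etaRateIneq342_of_hasMaj (liftBlk (cvBlk d L i.m i.kk hL) ι) (liftBlk (cvBlk d L i.m i.kk hL ∘ kingPrV L i.kk i.r (cvM d L i.m i.kk hL)) ι) hη0 hLr.le hB₀.le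
    (sfqrOps d mm ι a e hL i (E i)) A' fun n => ?_
  by_cases hn : n = 0
  · -- ENTRY 0: n15-c∕188
    subst hn
    rw [sfqrOps_zero]
    obtain ⟨hskew, h1F, h2F, h3F⟩ := (sfInstance_reg335_iff d mm ι hL i c35 α₀ A').1 hA'
    have hconv : ((L : ℝ) ^ i.kk)⁻¹ * ((L : ℝ) ^ i.r)⁻¹ = ((((L ^ i.r * L ^ i.kk : ℕ) : ℝ))⁻¹) := by
      push_cast
      rw [mul_inv, mul_comm]
    have hrA0 : 0 ≤ (c35 * (L : ℝ) ^ i.m * α₀) := by positivity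
    have hrAa : (c35 * (L : ℝ) ^ i.m * α₀) ≤ c35 * a₀ := by
      rw [mul_assoc]; exact mul_le_mul_of_nonneg_left hMa hc35.le
    -- Frobenius letters of the class ⟹ operator-norm letters
    have h1 : ∀ μ x', ‖A' μ x'‖ ≤ (c35 * (L : ℝ) ^ i.m * α₀) := fun μ x' => (l2_opNorm_le_frobenius_norm _).trans (h1F μ x')
    have h2' : ∀ μ κ x', ‖A' μ (bshiftEquiv (cvM d L i.m i.kk hL) (L ^ i.r * L ^ i.kk) κ x') - A' μ x'‖ ≤ (c35 * (L : ℝ) ^ i.m * α₀) * ((((L ^ i.r * L ^ i.kk : ℕ) : ℝ))⁻¹) :=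
      fun μ κ x' => ((l2_opNorm_le_frobenius_norm _).trans (h2F μ κ x')).trans_eq (by rw [hconv])
    have h3' : ∀ μ κ x', ‖(A' μ (bshiftEquiv (cvM d L i.m i.kk hL) (L ^ i.r * L ^ i.kk) κ x') - A' μ x') -
        (A' μ (bshiftEquiv (cvM d L i.m i.kk hL) (L ^ i.r * L ^ i.kk) κ ((bshiftEquiv (cvM d L i.m i.kk hL) (L ^ i.r * L ^ i.kk) μ).symm x')) -
          A' μ ((bshiftEquiv (cvM d L i.m i.kk hL) (L ^ i.r * L ^ i.kk) μ).symm x'))‖ ≤ (c35 * (L : ℝ) ^ i.m * α₀) * ((((L ^ i.r * L ^ i.kk : ℕ) : ℝ))⁻¹) * ((((L ^ i.r * L ^ i.kk : ℕ) : ℝ))⁻¹) :=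
      fun μ κ x' => ((l2_opNorm_le_frobenius_norm _).trans (h3F μ κ x')).trans_eq (by rw [hconv])
    -- the window `W·r_A ≤ 1`, hence `r_A ≤ 1`
    have hWa : W * (c35 * a₀) ≤ 1 := by
      calc W * (c35 * a₀) ≤ W * (c35 * aW) := mul_le_mul_of_nonneg_left (mul_le_mul_of_nonneg_left ha₀W hc35.le) hW0.le
        _ = 1 := by
          show W * (c35 * (1 / (W * c35))) = 1
          field_simp
    have hr2 : 2 * ((1 + Fintype.card (Fin (d + 1))) * ((3 + 2 * ((d : ℝ) + 1)) * (c35 * (L : ℝ) ^ i.m * α₀))) ≤ 1 := by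
      calc 2 * ((1 + Fintype.card (Fin (d + 1))) * ((3 + 2 * ((d : ℝ) + 1)) * (c35 * (L : ℝ) ^ i.m * α₀))) = W * (c35 * (L : ℝ) ^ i.m * α₀) := by ring
        _ ≤ W * (c35 * a₀) := mul_le_mul_of_nonneg_left hrAa hW0.le
        _ ≤ 1 := hWa
    have hca0 : 0 ≤ c35 * a₀ := by positivity
    have hrA1 : (c35 * (L : ℝ) ^ i.m * α₀) ≤ 1 := by
      calc (c35 * (L : ℝ) ^ i.m * α₀) ≤ c35 * a₀ := hrAa
        _ ≤ W * (c35 * a₀) := le_mul_of_one_le_left hca0 hW1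
        _ ≤ 1 := hWa
    -- the transporter sizes `K, K₁ ≤ 4(d+2)Λ·r_A ≤ 1`
    have hKa : 4 * ((d : ℝ) + 2) * Λ * (c35 * a₀) ≤ 1 := by
      calc 4 * ((d : ℝ) + 2) * Λ * (c35 * a₀) ≤ 4 * ((d : ℝ) + 2) * Λ * (c35 * aK) := mul_le_mul_of_nonneg_left (mul_le_mul_of_nonneg_left ha₀K hc35.le) (by positivity)
        _ ≤ (4 * ((d : ℝ) + 2) * Λ + 1) * (c35 * aK) := mul_le_mul_of_nonneg_right (by linarith) (by positivity)
        _ = 1 := by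
          show (4 * ((d : ℝ) + 2) * Λ + 1) * (c35 * (1 / ((4 * ((d : ℝ) + 2) * Λ + 1) * c35))) = 1
          field_simp
    have hKr : 4 * ((d : ℝ) + 2) * Λ * (c35 * (L : ℝ) ^ i.m * α₀) ≤ 1 := (mul_le_mul_of_nonneg_left hrAa (by positivity)).trans hKa
    have hx2 : 0 ≤ 2 * ((d : ℝ) + 2) * Λ * (c35 * (L : ℝ) ^ i.m * α₀) := by positivity
    have hx2' : 2 * ((d : ℝ) + 2) * Λ * (c35 * (L : ℝ) ^ i.m * α₀) ≤ 1 := by linarith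
    have hKc : ((1 + Fintype.card ι * (@basisConst ι _ (Matrix mm mm ℂ) Matrix.frobeniusNormedAddCommGroup Matrix.frobeniusNormedSpace e * (2 * Real.sqrt (Fintype.card mm)) * (Real.sqrt (Fintype.card mm) * (2 * ((c35 * (L : ℝ) ^ i.m * α₀) * ((((L ^ i.kk : ℕ) : ℝ))⁻¹)))))) ^ ((d + 2) * L ^ i.kk) - 1) ≤ 4 * ((d : ℝ) + 2) * Λ * (c35 * (L : ℝ) ^ i.m * α₀) := by
      have hy0 : 0 ≤ Fintype.card ι * (@basisConst ι _ (Matrix mm mm ℂ) Matrix.frobeniusNormedAddCommGroup Matrix.frobeniusNormedSpace e * (2 * Real.sqrt (Fintype.card mm)) * (Real.sqrt (Fintype.card mm) * (2 * ((c35 * (L : ℝ) ^ i.m * α₀) * ((((L ^ i.kk : ℕ) : ℝ))⁻¹))))) := by positivity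
      refine (pow_sub_one_le_exp_sub_one hy0 _).trans ?_
      have hexp : Fintype.card ι * (@basisConst ι _ (Matrix mm mm ℂ) Matrix.frobeniusNormedAddCommGroup Matrix.frobeniusNormedSpace e * (2 * Real.sqrt (Fintype.card mm)) * (Real.sqrt (Fintype.card mm) * (2 * ((c35 * (L : ℝ) ^ i.m * α₀) * ((((L ^ i.kk : ℕ) : ℝ))⁻¹))))) * (((d + 2) * L ^ i.kk : ℕ) : ℝ) = 2 * ((d : ℝ) + 2) * Λ * (c35 * (L : ℝ) ^ i.m * α₀) := by
        have hk0 : (((L ^ i.kk : ℕ) : ℝ)) ≠ 0 := by rw [hcast]; exact hxpos.ne'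
        push_cast
        field_simp
        ring
      rw [hexp]
      have h := exp_sub_one_le_two_mul hx2 hx2'
      linarith
    have hKf : ((1 + Fintype.card ι * (@basisConst ι _ (Matrix mm mm ℂ) Matrix.frobeniusNormedAddCommGroup Matrix.frobeniusNormedSpace e * (2 * Real.sqrt (Fintype.card mm)) * (Real.sqrt (Fintype.card mm) * (2 * ((c35 * (L : ℝ) ^ i.m * α₀) * ((((L ^ i.r * L ^ i.kk : ℕ) : ℝ))⁻¹)))))) ^ ((d + 2) * (L ^ i.r * L ^ i.kk)) - 1) ≤ 4 * ((d : ℝ) + 2) * Λ * (c35 * (L : ℝ) ^ i.m * α₀) := by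
      have hy0 : 0 ≤ Fintype.card ι * (@basisConst ι _ (Matrix mm mm ℂ) Matrix.frobeniusNormedAddCommGroup Matrix.frobeniusNormedSpace e * (2 * Real.sqrt (Fintype.card mm)) * (Real.sqrt (Fintype.card mm) * (2 * ((c35 * (L : ℝ) ^ i.m * α₀) * ((((L ^ i.r * L ^ i.kk : ℕ) : ℝ))⁻¹))))) := by positivity
      refine (pow_sub_one_le_exp_sub_one hy0 _).trans ?_
      have hexp : Fintype.card ι * (@basisConst ι _ (Matrix mm mm ℂ) Matrix.frobeniusNormedAddCommGroup Matrix.frobeniusNormedSpace e * (2 * Real.sqrt (Fintype.card mm)) * (Real.sqrt (Fintype.card mm) * (2 * ((c35 * (L : ℝ) ^ i.m * α₀) * ((((L ^ i.r * L ^ i.kk : ℕ) : ℝ))⁻¹))))) * (((d + 2) * (L ^ i.r * L ^ i.kk) : ℕ) : ℝ) = 2 * ((d : ℝ) + 2) * Λ * (c35 * (L : ℝ) ^ i.m * α₀) := by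
        have hk0 : (((L ^ i.r * L ^ i.kk : ℕ) : ℝ)) ≠ 0 := Nat.cast_ne_zero.mpr (Nat.pos_iff_ne_zero.mp (Nat.mul_pos (pow_pos hLpos _) (pow_pos hLpos _)))
        field_simp
        push_cast
        ring
      rw [hexp]
      have h := exp_sub_one_le_two_mul hx2 hx2'
      linarith
    have hKc1 : ((1 + Fintype.card ι * (@basisConst ι _ (Matrix mm mm ℂ) Matrix.frobeniusNormedAddCommGroup Matrix.frobeniusNormedSpace e * (2 * Real.sqrt (Fintype.card mm)) * (Real.sqrt (Fintype.card mm) * (2 * ((c35 * (L : ℝ) ^ i.m * α₀) * ((((L ^ i.kk : ℕ) : ℝ))⁻¹)))))) ^ ((d + 2) * L ^ i.kk) - 1) ≤ 1 := hKc.trans hKr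
    have hKf1 : ((1 + Fintype.card ι * (@basisConst ι _ (Matrix mm mm ℂ) Matrix.frobeniusNormedAddCommGroup Matrix.frobeniusNormedSpace e * (2 * Real.sqrt (Fintype.card mm)) * (Real.sqrt (Fintype.card mm) * (2 * ((c35 * (L : ℝ) ^ i.m * α₀) * ((((L ^ i.r * L ^ i.kk : ℕ) : ℝ))⁻¹)))))) ^ ((d + 2) * (L ^ i.r * L ^ i.kk)) - 1) ≤ 1 := hKf.trans hKr
    have hKC0 : 0 ≤ ((1 + Fintype.card ι * (@basisConst ι _ (Matrix mm mm ℂ) Matrix.frobeniusNormedAddCommGroup Matrix.frobeniusNormedSpace e * (2 * Real.sqrt (Fintype.card mm)) * (Real.sqrt (Fintype.card mm) * (2 * ((c35 * (L : ℝ) ^ i.m * α₀) * ((((L ^ i.kk : ℕ) : ℝ))⁻¹)))))) ^ ((d + 2) * L ^ i.kk) - 1) := by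
      have := one_le_pow₀ (M₀ := ℝ) (a := 1 + Fintype.card ι * (@basisConst ι _ (Matrix mm mm ℂ) Matrix.frobeniusNormedAddCommGroup Matrix.frobeniusNormedSpace e * (2 * Real.sqrt (Fintype.card mm)) * (Real.sqrt (Fintype.card mm) * (2 * ((c35 * (L : ℝ) ^ i.m * α₀) * ((((L ^ i.kk : ℕ) : ℝ))⁻¹)))))) (by linarith [show (0:ℝ) ≤ Fintype.card ι * (@basisConst ι _ (Matrix mm mm ℂ) Matrix.frobeniusNormedAddCommGroup Matrix.frobeniusNormedSpace e * (2 * Real.sqrt (Fintype.card mm)) * (Real.sqrt (Fintype.card mm) * (2 * ((c35 * (L : ℝ) ^ i.m * α₀) * ((((L ^ i.kk : ℕ) : ℝ))⁻¹))))) by positivity]) (n := (d + 2) * L ^ i.kk); linarith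
    have hKF0 : 0 ≤ ((1 + Fintype.card ι * (@basisConst ι _ (Matrix mm mm ℂ) Matrix.frobeniusNormedAddCommGroup Matrix.frobeniusNormedSpace e * (2 * Real.sqrt (Fintype.card mm)) * (Real.sqrt (Fintype.card mm) * (2 * ((c35 * (L : ℝ) ^ i.m * α₀) * ((((L ^ i.r * L ^ i.kk : ℕ) : ℝ))⁻¹)))))) ^ ((d + 2) * (L ^ i.r * L ^ i.kk)) - 1) := by
      have := one_le_pow₀ (M₀ := ℝ) (a := 1 + Fintype.card ι * (@basisConst ι _ (Matrix mm mm ℂ) Matrix.frobeniusNormedAddCommGroup Matrix.frobeniusNormedSpace e * (2 * Real.sqrt (Fintype.card mm)) * (Real.sqrt (Fintype.card mm) * (2 * ((c35 * (L : ℝ) ^ i.m * α₀) * ((((L ^ i.r * L ^ i.kk : ℕ) : ℝ))⁻¹)))))) (by linarith [show (0:ℝ) ≤ Fintype.card ι * (@basisConst ι _ (Matrix mm mm ℂ) Matrix.frobeniusNormedAddCommGroup Matrix.frobeniusNormedSpace e * (2 * Real.sqrt (Fintype.card mm)) * (Real.sqrt (Fintype.card mm) * (2 * ((c35 * (L : ℝ)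 ^ i.m * α₀) * ((((L ^ i.r * L ^ i.kk : ℕ) : ℝ))⁻¹))))) by positivity]) (n := (d + 2) * (L ^ i.r * L ^ i.kk)); linarith
    have hKsum : R₁ * (((1 + Fintype.card ι * (@basisConst ι _ (Matrix mm mm ℂ) Matrix.frobeniusNormedAddCommGroup Matrix.frobeniusNormedSpace e * (2 * Real.sqrt (Fintype.card mm)) * (Real.sqrt (Fintype.card mm) * (2 * ((c35 * (L : ℝ) ^ i.m * α₀) * ((((L ^ i.kk : ℕ) : ℝ))⁻¹)))))) ^ ((d + 2) * L ^ i.kk) - 1) + ((1 + Fintype.card ι * (@basisConst ι _ (Matrix mm mm ℂ) Matrix.frobeniusNormedAddCommGroup Matrix.frobeniusNormedSpace e * (2 * Real.sqrt (Fintype.card mm)) * (Real.sqrt (Fintype.card mm) * (2 * ((c35 * (L : ℝ) ^ i.m * α₀) * ((((L ^ i.r * L ^ i.kk : ℕ) : ℝ))⁻¹)))))) ^ ((d + 2) * (L ^ i.r * L ^ i.kk)) - 1)) ≤ R₁ * G * (c35 * a₀) := by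
      have h8 : ((1 + Fintype.card ι * (@basisConst ι _ (Matrix mm mm ℂ) Matrix.frobeniusNormedAddCommGroup Matrix.frobeniusNormedSpace e * (2 * Real.sqrt (Fintype.card mm)) * (Real.sqrt (Fintype.card mm) * (2 * ((c35 * (L : ℝ) ^ i.m * α₀) * ((((L ^ i.kk : ℕ) : ℝ))⁻¹)))))) ^ ((d + 2) * L ^ i.kk) - 1) + ((1 + Fintype.card ι * (@basisConst ι _ (Matrix mm mm ℂ) Matrix.frobeniusNormedAddCommGroup Matrix.frobeniusNormedSpace e * (2 * Real.sqrt (Fintype.card mm)) * (Real.sqrt (Fintype.card mm) * (2 * ((c35 * (L : ℝ) ^ i.m * α₀) * ((((L ^ i.r * L ^ i.kk : ℕ) : ℝ))⁻¹)))))) ^ ((d + 2) * (L ^ i.r * L ^ i.kk)) - 1) ≤ G * (c35 * (L : ℝ) ^ i.m * α₀) := by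
        show ((1 + Fintype.card ι * (@basisConst ι _ (Matrix mm mm ℂ) Matrix.frobeniusNormedAddCommGroup Matrix.frobeniusNormedSpace e * (2 * Real.sqrt (Fintype.card mm)) * (Real.sqrt (Fintype.card mm) * (2 * ((c35 * (L : ℝ) ^ i.m * α₀) * ((((L ^ i.kk : ℕ) : ℝ))⁻¹)))))) ^ ((d + 2) * L ^ i.kk) - 1) + ((1 + Fintype.card ι * (@basisConst ι _ (Matrix mm mm ℂ) Matrix.frobeniusNormedAddCommGroup Matrix.frobeniusNormedSpace e * (2 * Real.sqrt (Fintype.card mm)) * (Real.sqrt (Fintype.card mm) * (2 * ((c35 * (L : ℝ) ^ i.m * α₀) * ((((L ^ i.r * L ^ i.kk : ℕ) : ℝ))⁻¹)))))) ^ ((d + 2) * (L ^ i.r * L ^ i.kk)) - 1) ≤ 8 * ((d : ℝ) + 2) * Λ * (c35 * (L : ℝ) ^ i.m * α₀)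
        linarith
      calc R₁ * (((1 + Fintype.card ι * (@basisConst ι _ (Matrix mm mm ℂ) Matrix.frobeniusNormedAddCommGroup Matrix.frobeniusNormedSpace e * (2 * Real.sqrt (Fintype.card mm)) * (Real.sqrt (Fintype.card mm) * (2 * ((c35 * (L : ℝ) ^ i.m * α₀) * ((((L ^ i.kk : ℕ) : ℝ))⁻¹)))))) ^ ((d + 2) * L ^ i.kk) - 1) + ((1 + Fintype.card ι * (@basisConst ι _ (Matrix mm mm ℂ) Matrix.frobeniusNormedAddCommGroup Matrix.frobeniusNormedSpace e * (2 * Real.sqrt (Fintype.card mm)) * (Real.sqrt (Fintype.card mm) * (2 * ((c35 * (L : ℝ) ^ i.m * α₀) * ((((L ^ i.r * L ^ i.kk : ℕ) : ℝ))⁻¹)))))) ^ ((d + 2) * (L ^ i.r * L ^ i.kk)) - 1)) ≤ R₁ * (G * (c35 * (L : ℝ) ^ i.m * α₀)) := mul_le_mul_of_nonneg_left h8 hR₁.le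
        _ ≤ R₁ * (G * (c35 * a₀)) := mul_le_mul_of_nonneg_left (mul_le_mul_of_nonneg_left hrAa hG0) hR₁.le
        _ = R₁ * G * (c35 * a₀) := by ring
    -- the scale conditions of n15-c∕188
    have hscale : (14 * Real.exp 1 * (1 + Fintype.card (Fin (d + 1))) * basisConst e * ((1 + Fintype.card (Fin (d + 1))) * ((3 + 2 * ((d : ℝ) + 1)) * (c35 * (L : ℝ) ^ i.m * α₀)))) = σ * (c35 * (L : ℝ) ^ i.m * α₀) := by ring
    have hSle : σ * (c35 * (L : ℝ) ^ i.m * α₀) ≤ σ * (c35 * a₀) := mul_le_mul_of_nonneg_left hrAa hσ0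
    have hRle : (14 * Real.exp 1 * (1 + Fintype.card (Fin (d + 1))) * basisConst e * ((1 + Fintype.card (Fin (d + 1))) * ((3 + 2 * ((d : ℝ) + 1)) * (c35 * (L : ℝ) ^ i.m * α₀)))) * (1 + Fintype.card (Fin (d + 1) ⊕ Fin (d + 1))) + (R₁ * (((1 + Fintype.card ι * (@basisConst ι _ (Matrix mm mm ℂ) Matrix.frobeniusNormedAddCommGroup Matrix.frobeniusNormedSpace e * (2 * Real.sqrt (Fintype.card mm)) * (Real.sqrt (Fintype.card mm) * (2 * ((c35 * (L : ℝ) ^ i.m * α₀) * ((((L ^ i.kk : ℕ) : ℝ))⁻¹)))))) ^ ((d + 2) * L ^ i.kk) - 1) + ((1 + Fintype.card ι * (@basisConst ι _ (Matrix mm mm ℂ) Matrix.frobeniusNormedAddCommGroup Matrix.frobeniusNormedSpace e * (2 * Real.sqrt (Fintype.card mm)) * (Real.sqrt (Fintype.card mm) * (2 * ((c35 * (L : ℝ) ^ i.m * α₀) * ((((L ^ i.r * L ^ i.kk : ℕ) : ℝ))⁻¹)))))) ^ ((d + 2) * (L ^ i.r * L ^ i.kk)) - 1)) + (cR * (c35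 * (L : ℝ) ^ i.m * α₀))) ≤ R₀ := by
      rw [hscale]
      have hRa : (σ * c35 * JJ + R₁ * G * c35 + cR * c35) * aR ≤ R₀ := by
        have hden : 0 < σ * c35 * JJ + R₁ * G * c35 + cR * c35 + 1 := by positivity
        calc (σ * c35 * JJ + R₁ * G * c35 + cR * c35) * aR = R₀ * (σ * c35 * JJ + R₁ * G * c35 + cR * c35) / (σ * c35 * JJ + R₁ * G * c35 + cR * c35 + 1) := by
              show (σ * c35 * JJ + R₁ * G * c35 + cR * c35) * (R₀ / (σ * c35 * JJ + R₁ * G * c35 + cR * c35 + 1)) = R₀ * (σ * c35 * JJ + R₁ * G * c35 + cR * c35) / (σ * c35 * JJ + R₁ * G * c35 + cR * c35 + 1)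
              field_simp
          _ ≤ R₀ * (σ * c35 * JJ + R₁ * G * c35 + cR * c35 + 1) / (σ * c35 * JJ + R₁ * G * c35 + cR * c35 + 1) :=
              div_le_div_of_nonneg_right (mul_le_mul_of_nonneg_left (by linarith) hR₀.le) hden.le
          _ = R₀ := by field_simp
      have hco0 : 0 ≤ σ * c35 * JJ + R₁ * G * c35 + cR * c35 := by positivity
      have hcRa : cR * (c35 * (L : ℝ) ^ i.m * α₀) ≤ cR * (c35 * a₀) := mul_le_mul_of_nonneg_left hrAa hcR
      calc σ * (c35 * (L : ℝ) ^ i.m * α₀) * JJ + (R₁ * (((1 + Fintype.card ι * (@basisConst ι _ (Matrix mm mm ℂ) Matrix.frobeniusNormedAddCommGroup Matrix.frobeniusNormedSpace e * (2 * Real.sqrt (Fintype.card mm)) * (Real.sqrt (Fintype.card mm) * (2 * ((c35 * (L : ℝ) ^ i.m * α₀) * ((((L ^ i.kk : ℕ) : ℝ))⁻¹)))))) ^ ((d + 2) * L ^ i.kk) - 1) + ((1 + Fintype.card ι * (@basisConst ι _ (Matrix mm mm ℂ) Matrix.frobeniusNormedAddCommGroup Matrix.frobeniusNormedSpace e * (2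 * Real.sqrt (Fintype.card mm)) * (Real.sqrt (Fintype.card mm) * (2 * ((c35 * (L : ℝ) ^ i.m * α₀) * ((((L ^ i.r * L ^ i.kk : ℕ) : ℝ))⁻¹)))))) ^ ((d + 2) * (L ^ i.r * L ^ i.kk)) - 1)) + (cR * (c35 * (L : ℝ) ^ i.m * α₀))) ≤ σ * (c35 * a₀) * JJ + (R₁ * G * (c35 * a₀) + cR * (c35 * a₀)) :=
            add_le_add (mul_le_mul_of_nonneg_right hSle hJJ0) (add_le_add hKsum hcRa)
        _ = (σ * c35 * JJ + R₁ * G * c35 + cR * c35) * a₀ := by ring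
        _ ≤ (σ * c35 * JJ + R₁ * G * c35 + cR * c35) * aR := mul_le_mul_of_nonneg_left ha₀R hco0
        _ ≤ R₀ := hRa
    have hθle : R₁ * (((1 + Fintype.card ι * (@basisConst ι _ (Matrix mm mm ℂ) Matrix.frobeniusNormedAddCommGroup Matrix.frobeniusNormedSpace e * (2 * Real.sqrt (Fintype.card mm)) * (Real.sqrt (Fintype.card mm) * (2 * ((c35 * (L : ℝ) ^ i.m * α₀) * ((((L ^ i.kk : ℕ) : ℝ))⁻¹)))))) ^ ((d + 2) * L ^ i.kk) - 1) + ((1 + Fintype.card ι * (@basisConst ι _ (Matrix mm mm ℂ) Matrix.frobeniusNormedAddCommGroup Matrix.frobeniusNormedSpace e * (2 * Real.sqrt (Fintype.card mm)) * (Real.sqrt (Fintype.card mm) * (2 * ((c35 * (L : ℝ) ^ i.m * α₀) * ((((L ^ i.r * L ^ i.kk : ℕ) : ℝ))⁻¹)))))) ^ ((d + 2) * (L ^ i.r * L ^ i.kk)) - 1)) + (cR * (c35 * (L : ℝ) ^ i.m * α₀)) ≤ θ₀ := by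
      have hθa : (R₁ * G * c35 + cR * c35) * aθ ≤ θ₀ := by
        have hden : 0 < R₁ * G * c35 + cR * c35 + 1 := by positivity
        calc (R₁ * G * c35 + cR * c35) * aθ = θ₀ * (R₁ * G * c35 + cR * c35) / (R₁ * G * c35 + cR * c35 + 1) := by
              show (R₁ * G * c35 + cR * c35) * (θ₀ / (R₁ * G * c35 + cR * c35 + 1)) = θ₀ * (R₁ * G * c35 + cR * c35) / (R₁ * G * c35 + cR * c35 + 1)
              field_simp
          _ ≤ θ₀ * (R₁ * G * c35 + cR * c35 + 1) / (R₁ * G * c35 + cR * c35 + 1) := div_le_div_of_nonneg_right (mul_le_mul_of_nonneg_left (by linarith) hθ₀.le) hden.le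
          _ = θ₀ := by field_simp
      have hco0 : 0 ≤ R₁ * G * c35 + cR * c35 := by positivity
      have hcRa : cR * (c35 * (L : ℝ) ^ i.m * α₀) ≤ cR * (c35 * a₀) := mul_le_mul_of_nonneg_left hrAa hcR
      calc R₁ * (((1 + Fintype.card ι * (@basisConst ι _ (Matrix mm mm ℂ) Matrix.frobeniusNormedAddCommGroup Matrix.frobeniusNormedSpace e * (2 * Real.sqrt (Fintype.card mm)) * (Real.sqrt (Fintype.card mm) * (2 * ((c35 * (L : ℝ) ^ i.m * α₀) * ((((L ^ i.kk : ℕ) : ℝ))⁻¹)))))) ^ ((d + 2) * L ^ i.kk) - 1) + ((1 + Fintype.card ι * (@basisConst ι _ (Matrix mm mm ℂ) Matrix.frobeniusNormedAddCommGroup Matrix.frobeniusNormedSpace e * (2 * Real.sqrt (Fintype.card mm)) * (Real.sqrt (Fintype.card mm) * (2 * ((c35 * (L : ℝ) ^ i.m * α₀) * ((((L ^ i.r * L ^ i.kk : ℕ) : ℝ))⁻¹)))))) ^ ((d + 2) * (L ^ i.r * L ^ i.kk)) - 1)) + (cR * (c35 * (L : ℝ) ^ i.m * α₀)) ≤ R₁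 * G * (c35 * a₀) + cR * (c35 * a₀) := add_le_add hKsum hcRa
        _ = (R₁ * G * c35 + cR * c35) * a₀ := by ring
        _ ≤ (R₁ * G * c35 + cR * c35) * aθ := mul_le_mul_of_nonneg_left ha₀θ hco0
        _ ≤ θ₀ := hθa
    -- the Landau rows at the hypothesis' rate `δ_R ≥ δ`, read at the knit's rate `δ`
    obtain ⟨hG1, hG2, hG3⟩ := hG i α₀ hα₀ (hMa.trans ha₀G) A' hA'
    obtain ⟨hR1, hR2, hR3, hR4, hR5, hR6⟩ := cv_landauRows_of_global e i.m i.kk i.r hL a (by positivity) (by positivity) (mul_nonneg hCR (Real.rpow_nonneg hxpos.le _)) hG1 hG2 hG3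
    have hRR0 : 0 ≤ (cR * (c35 * (L : ℝ) ^ i.m * α₀)) := mul_nonneg hcR hrA0
    have hOR0 : 0 ≤ (CR * ((L : ℝ) ^ i.kk) ^ (-γR)) := mul_nonneg hCR (Real.rpow_nonneg hxpos.le _)
    have hmonoR : ∀ (c : ℝ) (y y' : Tor (cvM d L i.m i.kk hL)), 0 ≤ c →
        c * Real.exp (-(δR * (unitTorusGeo L i.kk (cvM d L i.m i.kk hL)).dist y y')) ≤ c * Real.exp (-(δ * (unitTorusGeo L i.kk (cvM d L i.m i.kk hL)).dist y y')) :=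
      fun c y y' hc => mul_le_mul_of_nonneg_left (Real.exp_le_exp.mpr (neg_le_neg (mul_le_mul_of_nonneg_right hδcap (unitTorusGeo_dist_nonneg L i.kk _ y y')))) hc
    have key := hasMaj_unitTorusGeoS (d := d) (L := L) ((L : ℝ) ^ i.m)
      (H i.m i.kk i.r i.one_le hw₀ e he A' hskew (c35 * (L : ℝ) ^ i.m * α₀) hrA0 hrA1 h1 h2' h3' hr2 (cR * (c35 * (L : ℝ) ^ i.m * α₀)) (cR * (c35 * (L : ℝ) ^ i.m * α₀)) (CR * ((L : ℝ) ^ i.kk) ^ (-γR)) (CR * ((L : ℝ) ^ i.kk) ^ (-γR)) hRR0 hRR0 hOR0 hOR0 hRle hθle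
        (fun k => (hR1 k).mono fun y y' => hmonoR _ y y' hRR0) (fun k => (hR2 k).mono fun y y' => hmonoR _ y y' hRR0) (fun k => (hR3 k).mono fun y y' => hmonoR _ y y' hOR0)
        (fun k => (hR4 k).mono fun y y' => hmonoR _ y y' hRR0) (fun k => (hR5 k).mono fun y y' => hmonoR _ y y' hRR0) (fun k => (hR6 k).mono fun y y' => hmonoR _ y y' hOR0) hKc1 hKf1)
    unfold sfqrEntry0
    refine key.mono fun y y' => ?_
    -- the scalar comparison of the two kernels
    rw [opGeo_len, sfGeo_len d hL i y, hrf y γ, hrf y' γ, max_self, hcast]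
    have hpref : B9.pref4 (1 : ℝ) 0 = 1 := by simp [B9.pref4]
    rw [hpref, mul_one]
    have hd0 : 0 ≤ (sfGeo d hL i).dist y y' := sfGeo_dist_nonneg d hL i y y'
    have hexp : Real.exp (-(δ / 16 * (Literature.MathematicalPhysics.QuantumFieldTheory.Balaban1983to89.B6UnitTorusCarrier.unitTorusGeo L i.kk (cvM d L i.m i.kk hL)).dist y y')) ≤ Real.exp (-(δ₀ * (sfGeo d hL i).dist y y')) := by
      refine Real.exp_le_exp.mpr (neg_le_neg ?_)
      exact mul_le_mul_of_nonneg_right hδ₀le hd0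
    have hE0 : 0 ≤ Real.exp (-(δ / 16 * (Literature.MathematicalPhysics.QuantumFieldTheory.Balaban1983to89.B6UnitTorusCarrier.unitTorusGeo L i.kk (cvM d L i.m i.kk hL)).dist y y')) := Real.exp_nonneg _
    have hre : σ * (c35 * (L : ℝ) ^ i.m * α₀) * (1 + Fintype.card (Fin (d + 1) ⊕ Fin (d + 1))) * ((L : ℝ) ^ i.kk)⁻¹ + 2 * (R₁ * (20 * ((L : ℝ) ^ i.kk)⁻¹ + 4 * Fintype.card ι * (@basisConst ι _ (Matrix mm mm ℂ) Matrix.frobeniusNormedAddCommGroup Matrix.frobeniusNormedSpace e * (2 * Real.sqrt (Fintype.card mm)) * (Real.sqrt (Fintype.card mm) * ((3 ^ (d + 1) * (72 * ((d : ℝ) + 1) ^ 2 + 9 * ((d : ℝ) + 1)) + (2 + 2 * Real.exp 1 + 2 * Real.exp 1 ^ 2 * ((d : ℝ) + 1))) * ((c35 * (L : ℝ) ^ i.m * α₀) * ((L : ℝ) ^ i.kk)⁻¹)))))) =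
        (σ * (c35 * (L : ℝ) ^ i.m * α₀) * JJ + 2 * (R₁ * (20 + 4 * (Λ * cΦ * (c35 * (L : ℝ) ^ i.m * α₀))))) * ((L : ℝ) ^ i.kk)⁻¹ := by
      show _ = (σ * (c35 * (L : ℝ) ^ i.m * α₀) * (1 + Fintype.card (Fin (d + 1) ⊕ Fin (d + 1))) + 2 * (R₁ * (20 + 4 * ((Fintype.card ι * (@basisConst ι _ (Matrix mm mm ℂ) Matrix.frobeniusNormedAddCommGroup Matrix.frobeniusNormedSpace e * (2 * Real.sqrt (Fintype.card mm)) * Real.sqrt (Fintype.card mm))) * (3 ^ (d + 1) * (72 * ((d : ℝ) + 1) ^ 2 + 9 * ((d : ℝ) + 1)) + (2 + 2 * Real.exp 1 + 2 * Real.exp 1 ^ 2 * ((d : ℝ) + 1))) * (c35 * (L : ℝ) ^ i.m * α₀))))) * ((L : ℝ) ^ i.kk)⁻¹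
      ring
    have hC₁le : σ * (c35 * (L : ℝ) ^ i.m * α₀) * JJ + 2 * (R₁ * (20 + 4 * (Λ * cΦ * (c35 * (L : ℝ) ^ i.m * α₀)))) ≤ C₁ := by
      show σ * (c35 * (L : ℝ) ^ i.m * α₀) * JJ + 2 * (R₁ * (20 + 4 * (Λ * cΦ * (c35 * (L : ℝ) ^ i.m * α₀)))) ≤ σ * (c35 * a₀) * JJ + 2 * (R₁ * (20 + 4 * (Λ * cΦ * (c35 * a₀))))
      have h4 : Λ * cΦ * (c35 * (L : ℝ) ^ i.m * α₀) ≤ Λ * cΦ * (c35 * a₀) := mul_le_mul_of_nonneg_left hrAa (mul_nonneg hΛ0 hcΦ0)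
      have h5 : R₁ * (20 + 4 * (Λ * cΦ * (c35 * (L : ℝ) ^ i.m * α₀))) ≤ R₁ * (20 + 4 * (Λ * cΦ * (c35 * a₀))) := mul_le_mul_of_nonneg_left (by linarith) hR₁.le
      linarith [mul_le_mul_of_nonneg_right hSle hJJ0, h5]
    have hbr : ((L : ℝ) ^ i.kk) ^ (-(1 / 16 : ℝ)) + (σ * (c35 * (L : ℝ) ^ i.m * α₀) * (1 + Fintype.card (Fin (d + 1) ⊕ Fin (d + 1))) * ((L : ℝ) ^ i.kk)⁻¹ + 2 * (R₁ * (20 * ((L : ℝ) ^ i.kk)⁻¹ + 4 * Fintype.card ι * (@basisConst ι _ (Matrix mm mm ℂ) Matrix.frobeniusNormedAddCommGroup Matrix.frobeniusNormedSpace e * (2 * Real.sqrt (Fintype.card mm)) * (Real.sqrt (Fintype.card mm) * ((3 ^ (d + 1) * (72 * ((d : ℝ) + 1) ^ 2 + 9 * ((d : ℝ) + 1)) + (2 + 2 * Real.exp 1 + 2 * Real.exp 1 ^ 2 * ((d : ℝ) + 1))) * ((c35 * (L : ℝ) ^ i.m * α₀) * ((L : ℝ) ^ i.kk)⁻¹))))))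 + ((CR * ((L : ℝ) ^ i.kk) ^ (-γR)) + (CR * ((L : ℝ) ^ i.kk) ^ (-γR)))) ≤
        (1 + C₁ + 2 * CR) * ((L : ℝ) ^ i.kk) ^ (-γ) := by
      have hA : ((L : ℝ) ^ i.kk) ^ (-(1 / 16 : ℝ)) ≤ ((L : ℝ) ^ i.kk) ^ (-γ) := hrfγ
      have hco0 : 0 ≤ σ * (c35 * (L : ℝ) ^ i.m * α₀) * JJ + 2 * (R₁ * (20 + 4 * (Λ * cΦ * (c35 * (L : ℝ) ^ i.m * α₀)))) := by positivity
      have hB : (σ * (c35 * (L : ℝ) ^ i.m * α₀) * JJ + 2 * (R₁ * (20 + 4 * (Λ * cΦ * (c35 * (L : ℝ) ^ i.m * α₀))))) * ((L : ℝ) ^ i.kk)⁻¹ ≤ C₁ * ((L : ℝ) ^ i.kk) ^ (-γ) :=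
        mul_le_mul hC₁le (hinv.trans hrfγ) (by positivity) hC₁0
      have hC : (CR * ((L : ℝ) ^ i.kk) ^ (-γR)) + (CR * ((L : ℝ) ^ i.kk) ^ (-γR)) ≤ 2 * CR * ((L : ℝ) ^ i.kk) ^ (-γ) := by
        have := mul_le_mul_of_nonneg_left hrfγR hCR
        linarith
      rw [hre]
      calc ((L : ℝ) ^ i.kk) ^ (-(1 / 16 : ℝ)) + ((σ * (c35 * (L : ℝ) ^ i.m * α₀) * JJ + 2 * (R₁ * (20 + 4 * (Λ * cΦ * (c35 * (L : ℝ) ^ i.m * α₀))))) * ((L : ℝ) ^ i.kk)⁻¹ + ((CR * ((L : ℝ) ^ i.kk) ^ (-γR)) + (CR * ((L : ℝ) ^ i.kk) ^ (-γR))))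
          ≤ ((L : ℝ) ^ i.kk) ^ (-γ) + (C₁ * ((L : ℝ) ^ i.kk) ^ (-γ) + 2 * CR * ((L : ℝ) ^ i.kk) ^ (-γ)) := add_le_add hA (add_le_add hB hC)
        _ = (1 + C₁ + 2 * CR) * ((L : ℝ) ^ i.kk) ^ (-γ) := by ring
    have hrpos : 0 ≤ ((L : ℝ) ^ i.kk) ^ (-γ) := Real.rpow_nonneg hxpos.le _
    calc D * (((L : ℝ) ^ i.kk) ^ (-(1 / 16 : ℝ)) + ((14 * Real.exp 1 * (1 + Fintype.card (Fin (d + 1))) * basisConst e * ((1 + Fintype.card (Fin (d + 1))) * ((3 + 2 * ((d : ℝ) + 1)) * (c35 * (L : ℝ) ^ i.m * α₀)))) * (1 + Fintype.card (Fin (d + 1) ⊕ Fin (d + 1))) * ((L : ℝ) ^ i.kk)⁻¹ + 2 * (R₁ * (20 * ((L : ℝ) ^ i.kk)⁻¹ + 4 * Fintype.card ι * (@basisConst ι _ (Matrix mm mm ℂ) Matrix.frobeniusNormedAddCommGroup Matrix.frobeniusNormedSpace e * (2 * Real.sqrt (Fintype.card mm)) * (Real.sqrt (Fintype.card mm) *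 ((3 ^ (d + 1) * (72 * ((d : ℝ) + 1) ^ 2 + 9 * ((d : ℝ) + 1)) + (2 + 2 * Real.exp 1 + 2 * Real.exp 1 ^ 2 * ((d : ℝ) + 1))) * ((c35 * (L : ℝ) ^ i.m * α₀) * ((L : ℝ) ^ i.kk)⁻¹)))))) + ((CR * ((L : ℝ) ^ i.kk) ^ (-γR)) + (CR * ((L : ℝ) ^ i.kk) ^ (-γR))))) * Real.exp (-(δ / 16 * (Literature.MathematicalPhysics.QuantumFieldTheory.Balaban1983to89.B6UnitTorusCarrier.unitTorusGeo L i.kk (cvM d L i.m i.kk hL)).dist y y'))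
        ≤ max D 0 * ((1 + C₁ + 2 * CR) * ((L : ℝ) ^ i.kk) ^ (-γ)) * Real.exp (-(δ / 16 * (Literature.MathematicalPhysics.QuantumFieldTheory.Balaban1983to89.B6UnitTorusCarrier.unitTorusGeo L i.kk (cvM d L i.m i.kk hL)).dist y y')) := by
          rw [hscale]
          refine mul_le_mul_of_nonneg_right ?_ hE0
          have hsum0 : 0 ≤ ((L : ℝ) ^ i.kk) ^ (-(1 / 16 : ℝ)) + (σ * (c35 * (L : ℝ) ^ i.m * α₀) * (1 + Fintype.card (Fin (d + 1) ⊕ Fin (d + 1))) * ((L : ℝ) ^ i.kk)⁻¹ + 2 * (R₁ * (20 * ((L : ℝ) ^ i.kk)⁻¹ + 4 * Fintype.card ι * (@basisConst ι _ (Matrix mm mm ℂ) Matrix.frobeniusNormedAddCommGroup Matrix.frobeniusNormedSpace e * (2 * Real.sqrt (Fintype.card mm)) * (Real.sqrt (Fintype.card mm) * ((3 ^ (d + 1) * (72 * ((d : ℝ) + 1) ^ 2 + 9 * ((d : ℝ) + 1)) + (2 + 2 * Real.exp 1 + 2 * Real.exp 1 ^ 2 * ((d : ℝ) + 1))) * ((c35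 * (L : ℝ) ^ i.m * α₀) * ((L : ℝ) ^ i.kk)⁻¹)))))) + ((CR * ((L : ℝ) ^ i.kk) ^ (-γR)) + (CR * ((L : ℝ) ^ i.kk) ^ (-γR)))) := by
            positivity
          exact (mul_le_mul_of_nonneg_right (le_max_left D 0) hsum0).trans (mul_le_mul_of_nonneg_left hbr (le_max_right _ _))
      _ ≤ max D 0 * ((1 + C₁ + 2 * CR) * ((L : ℝ) ^ i.kk) ^ (-γ)) * Real.exp (-(δ₀ * (sfGeo d hL i).dist y y')) := mul_le_mul_of_nonneg_left hexp (by positivity)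
      _ = (max D 0 * (1 + C₁ + 2 * CR)) * Real.exp (-(δ₀ * (sfGeo d hL i).dist y y')) * ((L : ℝ) ^ i.kk) ^ (-γ) := by ring
      _ ≤ B₀ * Real.exp (-(δ₀ * (sfGeo d hL i).dist y y')) * ((L : ℝ) ^ i.kk) ^ (-γ) := by
          refine mul_le_mul_of_nonneg_right (mul_le_mul_of_nonneg_right ?_ (Real.exp_nonneg _)) hrpos
          show max D 0 * (1 + C₁ + 2 * CR) ≤ max D 0 * (1 + C₁ + 2 * CR) + B₁
          linarith
  · -- ENTRIES 1–3: the displayed rows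
    rw [sfqrOps_of_ne_zero d mm ι a e hL i (E i) hn]
    refine (hE i hM₁' α₀ hα₀ hMa₁ A' hA' n hn).mono fun y y' => ?_
    rw [opGeo_len, sfGeo_len d hL i y, hrf y γ, hrf y' γ, hrf y γ₁, hrf y' γ₁, max_self, max_self]
    have hp0 : 0 ≤ B9.pref4 (1 : ℝ) n := (pref4_pos one_pos n).le
    have hd0 : 0 ≤ (sfGeo d hL i).dist y y' := sfGeo_dist_nonneg d hL i y y'
    have hexp : Real.exp (-(δ₁ * (sfGeo d hL i).dist y y')) ≤ Real.exp (-(δ₀ * (sfGeo d hL i).dist y y')) :=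
      Real.exp_le_exp.mpr (neg_le_neg (mul_le_mul_of_nonneg_right hδ₀le₁ hd0))
    have hBB : B₁ ≤ B₀ := by
      show B₁ ≤ max D 0 * (1 + C₁ + 2 * CR) + B₁
      have : 0 ≤ max D 0 * (1 + C₁ + 2 * CR) := by positivity
      linarith
    exact mul_le_mul (mul_le_mul (mul_le_mul_of_nonneg_right hBB hp0) hexp (Real.exp_nonneg _) (by positivity)) hrfγ₁ (Real.rpow_nonneg hxpos.le _) (by positivity)

end Node

end Summit.QuantumFields.YangMills.BalabanUVNodes.N15.Gluing

end
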